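import Literature.MathematicalPhysics.QuantumLattice.HubbardTTPrimeThermalPressureSpinSectors
import Literature.MathematicalPhysics.QuantumLattice.SpinSectorPartitionFnRelabel
import Literature.MathematicalPhysics.QuantumLattice.HubbardSpinFlipSymmetry
import HarnessLib

/-!
# The spin-resolved thermal pressure of the 2D `t–t'` Hubbard model is spin-flip symmetric and jointly
# concave in `(n↑, n↓)`; the `S^z = 0` sector dominates

Topic `MathematicalPhysics/QuantumLattice` (family `hubbard`); sequel of `HubbardTTPrimeThermalPressureSpinSectors.lean`
(the number `p(β; t,t',U; x, y) = pressureTT'₂ β t t' U x y`, `(x, y) = (n↑, n↓) ∈ [0,1)²`, with its volume-free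
density legs) and the two-species form of `HubbardTTPrimeThermalPressureDensity.lean` §3–§4.

* §1 **spin-flip symmetry** (`Γ = ` second quantisation of `(x,σ) ↦ (x, 1−σ)`, `Orb.spinSwap`): `Γ` maps the
  sector `(a, b)` onto `(b, a)` (`spinConfig_finsetCongr_spinSwap_iff`), so
  `Z_β(Γ A Γ⁻¹; a, b) = Z_β(A; b, a)` (`partitionFn_spinSectorHamiltonian_relabel_spinSwap`), and for the
  spin-swap-invariant torus Hamiltonian `Z(L×L; a, b) = Z(L×L; b, a)`
  (`partitionFn_spinSector_hubbardRectTorusTT'_spinSwap`), `p(x, y) = p(y, x)` (`pressureTT'₂_swap`);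
* §2 **the mixed tiling in two species** (`spinSectorPressureTT'_rows_le`): `K = k+1`, `a ≤ K`, the `KM × KM` torus
  tiled by `K²` blocks of side `M`, `aK` of them in the sector `(⌊x₁M²⌋, ⌊y₁M²⌋)` and the rest in
  `(⌊x₂M²⌋, ⌊y₂M²⌋)`; the `≤ K²` rounding electrons OF EACH SPECIES are added at the volume-free price
  `2 log(KM) + βκ₊` each (`log_partitionFn_up_steps_ge`, `…_down_steps_ge`):
  `(a/K) p_M(x₁,y₁) + ((K−a)/K) p_M(x₂,y₂) − (β(16|t|+32|t'|) + 4K)/M − 2β(4|t|+4|t'|+U)/M² ≤ p_{KM}(x̄, ȳ)`;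
* §3 **joint concavity at rational weights** (`pressureTT'₂_ratConcave`) and its two uses:
  **`S^z = 0` DOMINANCE** `p(x, y) ≤ p((x+y)/2, (x+y)/2) = pressureTT' β t t' U (x + y)` (`pressureTT'₂_le_diag`,
  `pressureTT'₂_le_pressureTT'`: midpoint concavity between `(x,y)` and `(y,x)` plus the symmetry) — the canonical
  `S^z = 0` free entropy of record is the LARGEST over all spin polarisations at the same filling, the `T > 0` twin
  of the Lieb–Mattis half `E(N, S^z) ≥ E(N, 0)` (`HubbardSzSectorMonotone`) — and **joint concavity**
  `ConcaveOn ℝ ([0,1) × [0,1)) p` (`concaveOn_pressureTT'₂`; real weights from the rational ones by the continuity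
  of `p` coming from its density legs).

Everything is PROVED; no definition, no named fact.

## Mathlib / tree search

REUSED: `relabel`, `relabel_apply_finsetCongr`, `relabelSign_mul_self`, `star_relabelSign`, `Orb.spinSwap(_orb)`
(`FermionRelabelling`), `relabel_spinSwap_hamiltonian` (`HubbardSpinFlipSymmetry`), `partitionFn_diagonal_conj`,
`partitionFn_submatrix_equiv` (`SpinSectorPartitionFnRelabel`, `HalfFillingGaussianDomination`),
`prod_partitionFn_hubbardRectTorusTT'_squares_le`, `log_partitionFn_spinSector_hubbardRectTorusTT'_succ_up_mem_local/_down_…`,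
`tendsto_spinSectorPressureTT'`, `pressureTT'₂_half_half`, `pressureTT'₂_sub_binEntropy_sub_mem_fst/_snd`,
Mathlib `Real.binEntropy_continuous`. `lean search 'pressureTT.₂.*swap|concaveOn_pressureTT.₂'`: nothing (2026-08-27).

## References

* D. Ruelle, *Statistical Mechanics: Rigorous Results* (1969), §3.4. [cite: Ruelle1969, §3.4]
* E. H. Lieb, D. Mattis, J. Math. Phys. 3 (1962) 749, §I; E. H. Lieb, Phys. Rev. Lett. 62 (1989) 1201, proof of
  Theorem 1 (the `(N↑,N↓)` sectors under spin flips). [cite: LiebPRL1989, proof of Theorem 1]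
-/

noncomputable section

namespace Literature.MathematicalPhysics.QuantumLattice

open Matrix Finset HubbardWave0 Literature.Probability.LatticeModels LiebThm1
open _root_.Filter
open scoped _root_.Topology ComplexOrder BigOperators

/-! ### §1 Spin-flip symmetry of the canonical partition functions -/

section SpinSwap

variable {Λ : Type*} [LinearOrder Λ] [Fintype Λ]

omit [LinearOrder Λ] [Fintype Λ] in
/-- `Γ⁻¹(x, σ) = (x, swap σ)` (the spin swap is an involution). [folklore] -/
private theorem spinSwap_symm_orb (x : Λ) (σ : Fin 2) :
    (Orb.spinSwap : Orb Λ ≃ Orb Λ).symm (orb x σ) = orb x (Equiv.swap (0 : Fin 2) 1 σ) := by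
  rw [Equiv.symm_apply_eq, Orb.spinSwap_orb, Equiv.swap_apply_self]

/-- Up sites of the spin-swapped configuration are the down sites (a Summits-side copy,
`Summit.HubbardSuperconductivity.….CooperPairDMottWalk.upPart_finsetCongr_spinSwap`, is not importable into
`Literature`; the 3-line proof is redone here). [cite: LiebPRL1989, proof of Theorem 1] -/
theorem upPart_finsetCongr_spinSwap (s : Finset (Orb Λ)) :
    upPart ((Orb.spinSwap : Orb Λ ≃ Orb Λ).finsetCongr s) = downPart s := by
  ext x
  rw [mem_upPart, Equiv.finsetCongr_apply, Finset.mem_map_equiv, spinSwap_symm_orb, Equiv.swap_apply_left,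
    mem_downPart]

/-- Down sites of the spin-swapped configuration are the up sites (Summits-side copy:
`….CooperPairDMottWalk.downPart_finsetCongr_spinSwap`, not importable here). [cite: LiebPRL1989, proof of Theorem 1] -/
theorem downPart_finsetCongr_spinSwap (s : Finset (Orb Λ)) :
    downPart ((Orb.spinSwap : Orb Λ ≃ Orb Λ).finsetCongr s) = upPart s := by
  ext x
  rw [mem_downPart, Equiv.finsetCongr_apply, Finset.mem_map_equiv, spinSwap_symm_orb, Equiv.swap_apply_right,
    mem_upPart]

/-- **The spin swap maps the sector `(b, a)` onto the sector `(a, b)`.** [cite: LiebPRL1989, proof of Theorem 1] -/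
theorem spinConfig_finsetCongr_spinSwap_iff (a b : ℕ) (s : Finset (Orb Λ)) :
    spinConfig a b ((Orb.spinSwap : Orb Λ ≃ Orb Λ).finsetCongr s) ↔ spinConfig b a s := by
  simp only [spinConfig, upPart_finsetCongr_spinSwap, downPart_finsetCongr_spinSwap]
  exact And.comm

/-- The induced bijection of sector configurations `(b, a) ≃ (a, b)`. [cite: LiebPRL1989, proof of Theorem 1] -/
def spinConfigSwapEquiv (a b : ℕ) : Subtype (spinConfig (Λ := Λ) b a) ≃ Subtype (spinConfig (Λ := Λ) a b) :=
  (Orb.spinSwap : Orb Λ ≃ Orb Λ).finsetCongr.subtypeEquiv fun s => (spinConfig_finsetCongr_spinSwap_iff a b s).symm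

/-- Unfolding: the underlying configuration of the image is `Γ s`. [cite: LiebPRL1989, proof of Theorem 1] -/
@[simp] theorem coe_spinConfigSwapEquiv (a b : ℕ) (c : Subtype (spinConfig (Λ := Λ) b a)) :
    ((spinConfigSwapEquiv a b c) : Finset (Orb Λ)) = (Orb.spinSwap : Orb Λ ≃ Orb Λ).finsetCongr c.1 := rfl

/-- The compression of `Γ A Γ⁻¹` to the sector `(a, b)` is the compression of `A` to `(b, a)`, conjugated by the
diagonal sign matrix and reindexed. [cite: BratteliRobinsonII1997, §5.2.2, Thm. 5.2.5] -/
theorem spinSectorHamiltonian_relabel_spinSwap (a b : ℕ) (A : Matrix (Finset (Orb Λ)) (Finset (Orb Λ)) ℂ) :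
    spinSectorHamiltonian a b (relabel (Orb.spinSwap : Orb Λ ≃ Orb Λ) A) =
      (diagonal (fun c : Subtype (spinConfig (Λ := Λ) b a) => relabelSign (Orb.spinSwap : Orb Λ ≃ Orb Λ) c.1) *
          spinSectorHamiltonian b a A *
          diagonal (fun c : Subtype (spinConfig (Λ := Λ) b a) =>
            relabelSign (Orb.spinSwap : Orb Λ ≃ Orb Λ) c.1)).submatrix
        (spinConfigSwapEquiv a b).symm (spinConfigSwapEquiv a b).symm := by
  ext c' d'
  obtain ⟨c, rfl⟩ := (spinConfigSwapEquiv a b).surjective c'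
  obtain ⟨d, rfl⟩ := (spinConfigSwapEquiv a b).surjective d'
  rw [submatrix_apply, Equiv.symm_apply_apply, Equiv.symm_apply_apply, mul_diagonal, diagonal_mul,
    spinSectorHamiltonian, submatrix_apply, spinSectorHamiltonian, submatrix_apply,
    coe_spinConfigSwapEquiv, coe_spinConfigSwapEquiv, relabel_apply_finsetCongr]

/-- **Canonical partition functions under the spin swap**: `Z_β(Γ A Γ⁻¹; a, b) = Z_β(A; b, a)`.
[cite: BratteliRobinsonII1997, §5.2.2, Thm. 5.2.5] -/
theorem partitionFn_spinSectorHamiltonian_relabel_spinSwap (β : ℝ) (a b : ℕ)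
    (A : Matrix (Finset (Orb Λ)) (Finset (Orb Λ)) ℂ) :
    partitionFn β (spinSectorHamiltonian a b (relabel (Orb.spinSwap : Orb Λ ≃ Orb Λ) A)) =
      partitionFn β (spinSectorHamiltonian b a A) := by
  rw [spinSectorHamiltonian_relabel_spinSwap, partitionFn_submatrix_equiv,
    partitionFn_diagonal_conj β _ (fun c => relabelSign_mul_self _ _) (fun c => star_relabelSign _ _)]

end SpinSwap

namespace ThermodynamicLimit

/-- The `t–t'` torus Hamiltonian is spin-swap invariant. [cite: LiebPRL1989, proof of Theorem 1] -/
theorem relabel_spinSwap_hubbardRectTorusTT' (L₁ L₂ : ℕ) (t t' U : ℝ) :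
    relabel (Orb.spinSwap : Orb (Fin L₁ ×ₗ Fin L₂) ≃ Orb (Fin L₁ ×ₗ Fin L₂)) (hubbardRectTorusTT' L₁ L₂ t t' U) =
      hubbardRectTorusTT' L₁ L₂ t t' U := by
  unfold hubbardRectTorusTT'
  rw [map_add, relabel_spinSwap_hamiltonian, relabel_spinSwap_hamiltonian]

/-- **Spin-flip symmetry of the torus canonical partition functions**: `Z(L₁×L₂; a, b) = Z(L₁×L₂; b, a)`.
[cite: LiebPRL1989, proof of Theorem 1] -/
theorem partitionFn_spinSector_hubbardRectTorusTT'_spinSwap (L₁ L₂ : ℕ) (t t' U β : ℝ) (a b : ℕ) :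
    partitionFn β (spinSectorHamiltonian a b (hubbardRectTorusTT' L₁ L₂ t t' U)) =
      partitionFn β (spinSectorHamiltonian b a (hubbardRectTorusTT' L₁ L₂ t t' U)) := by
  rw [← partitionFn_spinSectorHamiltonian_relabel_spinSwap β a b, relabel_spinSwap_hubbardRectTorusTT']

/-- Finite volume: `p_L(x, y) = p_L(y, x)`. [cite: LiebPRL1989, proof of Theorem 1] -/
theorem spinSectorPressureTT'_swap (β t t' U x y : ℝ) (L : ℕ) :
    spinSectorPressureTT' β t t' U x y L = spinSectorPressureTT' β t t' U y x L := by
  rw [spinSectorPressureTT', spinSectorPressureTT', partitionFn_spinSector_hubbardRectTorusTT'_spinSwap]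

/-- **Spin-flip symmetry of the spin-resolved pressure**: `p(β; t,t',U; x, y) = p(β; t,t',U; y, x)` (`x, y ∈ [0,1)`).
[cite: LiebPRL1989, proof of Theorem 1] -/
theorem pressureTT'₂_swap {β : ℝ} (hβ : 0 ≤ β) (t t' : ℝ) {U : ℝ} (hU : 0 ≤ U) {x y : ℝ} (hx0 : 0 ≤ x)
    (hx1 : x < 1) (hy0 : 0 ≤ y) (hy1 : y < 1) :
    pressureTT'₂ β t t' U x y = pressureTT'₂ β t t' U y x := by
  have h1 := tendsto_spinSectorPressureTT' hβ t t' hU hx0 hx1 hy0 hy1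
  have h2 := tendsto_spinSectorPressureTT' hβ t t' hU hy0 hy1 hx0 hx1
  simp_rw [spinSectorPressureTT'_swap β t t' U x y] at h1
  exact tendsto_nhds_unique h1 h2

/-! ### §2 The mixed tiling in two species -/

section Tiling

/-- Row sums: `Σ_{i < K} (if i < a then X else Y) = a X + (K - a) Y` for `a ≤ K`. [folklore] -/
private theorem sum_fin_ite_lt_of_le' {γ : Type*} [AddCommMonoid γ] (K a : ℕ) (ha : a ≤ K) (X Y : γ) :
    ∑ i : Fin K, (if (i : ℕ) < a then X else Y) = a • X + (K - a) • Y := by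
  rw [Fin.sum_univ_eq_sum_range (f := fun i => if i < a then X else Y), Finset.range_eq_Ico,
    ← Finset.sum_Ico_consecutive _ (Nat.zero_le a) ha]
  congr 1
  · rw [Finset.sum_congr rfl (fun i hi => if_pos (Finset.mem_Ico.1 hi).2), Finset.sum_const,
      Nat.card_Ico, Nat.sub_zero]
  · rw [Finset.sum_congr rfl (fun i hi => if_neg (not_lt.2 (Finset.mem_Ico.1 hi).1)),
      Finset.sum_const, Nat.card_Ico]

/-- `k_L ≤ nL²/2`. [folklore] -/
private theorem halfRectN_real_le' {n : ℝ} (hn0 : 0 ≤ n) (L : ℕ) : (halfRectN n L : ℝ) ≤ n / 2 * (L : ℝ) ^ 2 := by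
  unfold halfRectN
  have h := Nat.floor_le (a := n * (L : ℝ) ^ 2 / 2) (by positivity)
  linarith

/-- `nL²/2 − 1 < k_L`. [folklore] -/
private theorem halfRectN_real_gt' (n : ℝ) (L : ℕ) : n / 2 * (L : ℝ) ^ 2 - 1 < (halfRectN n L : ℝ) := by
  unfold halfRectN
  have h := Nat.lt_floor_add_one (n * (L : ℝ) ^ 2 / 2)
  linarith

/-- The division step of the mixed tiling, pure field arithmetic. [folklore] -/
private theorem rows_div_identity {a K M P₁ P₂ E κ : ℝ} (hK : K ≠ 0) (hM : M ≠ 0) :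
    (a / K * (P₁ / M ^ 2) + (K - a) / K * (P₂ / M ^ 2) - E / M - 2 * κ / M ^ 2) * (K * M) ^ 2 =
      K * (a * P₁ + (K - a) * P₂) - E * K ^ 2 * M - 2 * κ * K ^ 2 := by
  field_simp

/-- The final bookkeeping of the mixed tiling, pure linear arithmetic. [folklore] -/
private theorem rows_final_arith {β c M k K a P₁ P₂ Q₁ Q₂ κ : ℝ}
    (hlogtile : -(β * (c * M * k * (k + 1))) + K * (a * P₁ + (K - a) * P₂) ≤ Q₁)
    (hroundR : -(2 * K ^ 2 * (2 * (K * M) + κ)) ≤ Q₂ - Q₁)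
    (hkK : k * (k + 1) ≤ K ^ 2) (hβc : 0 ≤ β * c) (hM : 0 ≤ M) :
    K * (a * P₁ + (K - a) * P₂) - (β * c + 4 * K) * K ^ 2 * M - 2 * κ * K ^ 2 ≤ Q₂ := by
  have h1 : β * c * M * (k * (k + 1)) ≤ β * c * M * K ^ 2 := mul_le_mul_of_nonneg_left hkK (mul_nonneg hβc hM)
  nlinarith [h1]

variable (t t' U : ℝ) {β : ℝ} (hβ : 0 ≤ β)
include hβ

/-- **Adding `d` up electrons costs at most `d (log|Λ| + βκ₊)`** (`S + d ≤ |Λ| = L₁L₂`, `l ≤ |Λ|`, `|Λ| ≥ 1`): the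
volume-free transfer with the entropy factor bounded by `(|Λ|−k)/(k+1) ≥ 1/|Λ|`. [cite: Ruelle1969, §3.4] -/
theorem log_partitionFn_up_steps_ge (L₁ L₂ : ℕ) (hΛ : 1 ≤ L₁ * L₂) {l : ℕ} (hl : l ≤ L₁ * L₂) :
    ∀ (d S : ℕ), S + d ≤ L₁ * L₂ →
      -((d : ℝ) * (Real.log ((L₁ * L₂ : ℕ) : ℝ) + β * (4 * |t| + 4 * |t'| + max U 0))) ≤
        Real.log (partitionFn β (spinSectorHamiltonian (S + d) l (hubbardRectTorusTT' L₁ L₂ t t' U))).re -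
          Real.log (partitionFn β (spinSectorHamiltonian S l (hubbardRectTorusTT' L₁ L₂ t t' U))).re := by
  have hV : (1 : ℝ) ≤ ((L₁ * L₂ : ℕ) : ℝ) := by exact_mod_cast hΛ
  intro d
  induction d with
  | zero => intro S _; simp
  | succ d ih =>
      intro S hSd
      have h1 := ih (S + 1) (by omega)
      obtain ⟨h2, -⟩ := log_partitionFn_spinSector_hubbardRectTorusTT'_succ_up_mem_local L₁ L₂ t t' U hβ
        (k := S) (l := l) (by omega) hl
      have hent : -Real.log ((L₁ * L₂ : ℕ) : ℝ) ≤ Real.log (((((L₁ * L₂ : ℕ) : ℝ) - S)) / ((S : ℝ) + 1)) := by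
        have hS1 : (S : ℝ) + 1 ≤ ((L₁ * L₂ : ℕ) : ℝ) := by exact_mod_cast (show S + 1 ≤ L₁ * L₂ by omega)
        rw [← Real.log_inv]
        refine Real.log_le_log (by positivity) ?_
        rw [inv_eq_one_div, div_le_div_iff₀ (by positivity) (by positivity)]
        nlinarith
      have e : S + 1 + d = S + (d + 1) := by ring
      rw [e] at h1
      rw [Nat.cast_succ]
      linarith

/-- **Adding `d` down electrons costs at most `d (log|Λ| + βκ₊)`** (`k ≤ |Λ|`, `l + d ≤ |Λ|`).
[cite: Ruelle1969, §3.4] -/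
theorem log_partitionFn_down_steps_ge (L₁ L₂ : ℕ) (hΛ : 1 ≤ L₁ * L₂) {k : ℕ} (hk : k ≤ L₁ * L₂) :
    ∀ (d l : ℕ), l + d ≤ L₁ * L₂ →
      -((d : ℝ) * (Real.log ((L₁ * L₂ : ℕ) : ℝ) + β * (4 * |t| + 4 * |t'| + max U 0))) ≤
        Real.log (partitionFn β (spinSectorHamiltonian k (l + d) (hubbardRectTorusTT' L₁ L₂ t t' U))).re -
          Real.log (partitionFn β (spinSectorHamiltonian k l (hubbardRectTorusTT' L₁ L₂ t t' U))).re := by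
  have hV : (1 : ℝ) ≤ ((L₁ * L₂ : ℕ) : ℝ) := by exact_mod_cast hΛ
  intro d
  induction d with
  | zero => intro l _; simp
  | succ d ih =>
      intro l hld
      have h1 := ih (l + 1) (by omega)
      obtain ⟨h2, -⟩ := log_partitionFn_spinSector_hubbardRectTorusTT'_succ_down_mem_local L₁ L₂ t t' U hβ
        (k := k) (l := l) hk (by omega)
      have hent : -Real.log ((L₁ * L₂ : ℕ) : ℝ) ≤ Real.log (((((L₁ * L₂ : ℕ) : ℝ) - l)) / ((l : ℝ) + 1)) := by
        have hl1 : (l : ℝ) + 1 ≤ ((L₁ * L₂ : ℕ) : ℝ) := by exact_mod_cast (show l + 1 ≤ L₁ * L₂ by omega)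
        rw [← Real.log_inv]
        refine Real.log_le_log (by positivity) ?_
        rw [inv_eq_one_div, div_le_div_iff₀ (by positivity) (by positivity)]
        nlinarith
      have e : l + 1 + d = l + (d + 1) := by ring
      rw [e] at h1
      rw [Nat.cast_succ]
      linarith
set_option maxHeartbeats 400000 in
/-- **The mixed-tiling inequality in two species, at finite size.** For spin densities
`(x₁,y₁), (x₂,y₂) ∈ [0,1)²`, `K = k+1`, `a ≤ K`, `M ≥ 1`, with `x̄ = (a x₁ + (K−a) x₂)/K`, `ȳ = (a y₁ + (K−a) y₂)/K`:
`(a/K) p_M(x₁,y₁) + ((K−a)/K) p_M(x₂,y₂) − (β(16|t|+32|t'|) + 4K)/M − 2β(4|t|+4|t'|+max(U,0))/M² ≤ p_{KM}(x̄, ȳ)`.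
[cite: Ruelle1969, §3.4] -/
theorem spinSectorPressureTT'_rows_le {x₁ y₁ x₂ y₂ : ℝ} (hx₁ : 0 ≤ x₁) (hx₁' : x₁ < 1) (hy₁ : 0 ≤ y₁)
    (hy₁' : y₁ < 1) (hx₂ : 0 ≤ x₂) (hx₂' : x₂ < 1) (hy₂ : 0 ≤ y₂) (hy₂' : y₂ < 1) (k a : ℕ) (ha : a ≤ k + 1)
    {M : ℕ} (hM : 1 ≤ M) :
    (a / (k + 1 : ℕ)) * spinSectorPressureTT' β t t' U x₁ y₁ M +
        (((k + 1 : ℕ) - a) / (k + 1 : ℕ)) * spinSectorPressureTT' β t t' U x₂ y₂ M -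
        (β * (16 * |t| + 32 * |t'|) + 4 * (k + 1 : ℕ)) / M -
        2 * (β * (4 * |t| + 4 * |t'| + max U 0)) / (M : ℝ) ^ 2 ≤
      spinSectorPressureTT' β t t' U ((a * x₁ + ((k + 1 : ℕ) - a) * x₂) / (k + 1 : ℕ))
        ((a * y₁ + ((k + 1 : ℕ) - a) * y₂) / (k + 1 : ℕ)) ((k + 1) * M) := by
  have hKpos : (0 : ℝ) < (k + 1 : ℕ) := by positivity
  have hK1 : (1 : ℝ) ≤ ((k + 1 : ℕ) : ℝ) := by exact_mod_cast Nat.succ_pos k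
  have haK : (a : ℝ) ≤ (k + 1 : ℕ) := by exact_mod_cast ha
  have hKa : (0 : ℝ) ≤ ((k + 1 : ℕ) : ℝ) - a := by linarith
  have ha0 : (0 : ℝ) ≤ a := Nat.cast_nonneg a
  have hMpos : (0 : ℝ) < M := by exact_mod_cast hM
  have hM1 : (1 : ℝ) ≤ M := by exact_mod_cast hM
  obtain ⟨κ, hκ⟩ : ∃ κ : ℝ, β * (4 * |t| + 4 * |t'| + max U 0) = κ := ⟨_, rfl⟩
  have hκ0 : 0 ≤ κ := by rw [← hκ]; have := le_max_right U 0; positivity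
  rw [hκ]
  -- the barycentric densities, doubled (`halfRectN (2x) = ⌊x L²⌋`)
  set Z : ℝ := (a * x₁ + ((k + 1 : ℕ) - a) * x₂) / (k + 1 : ℕ) with hZdef
  set W : ℝ := (a * y₁ + ((k + 1 : ℕ) - a) * y₂) / (k + 1 : ℕ) with hWdef
  clear_value Z W
  have hbary : ∀ {u v : ℝ}, 0 ≤ u → u < 1 → 0 ≤ v → v < 1 →
      0 ≤ (a * u + ((k + 1 : ℕ) - a) * v) / (k + 1 : ℕ) ∧ (a * u + ((k + 1 : ℕ) - a) * v) / (k + 1 : ℕ) < 1 := by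
    intro u v hu hu' hv hv'
    constructor
    · apply div_nonneg _ hKpos.le
      have : 0 ≤ (((k + 1 : ℕ) : ℝ) - a) * v := mul_nonneg hKa hv
      positivity
    · rw [div_lt_iff₀ hKpos]
      have h1 : (a : ℝ) * u ≤ a * max u v := mul_le_mul_of_nonneg_left (le_max_left _ _) ha0
      have h2 : (((k + 1 : ℕ) : ℝ) - a) * v ≤ (((k + 1 : ℕ) : ℝ) - a) * max u v :=
        mul_le_mul_of_nonneg_left (le_max_right _ _) hKa
      have : max u v < 1 := max_lt hu' hv'
      nlinarith
  obtain ⟨hZ0, hZ1⟩ : 0 ≤ Z ∧ Z < 1 := by rw [hZdef]; exact hbary hx₁ hx₁' hx₂ hx₂'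
  obtain ⟨hW0, hW1⟩ : 0 ≤ W ∧ W < 1 := by rw [hWdef]; exact hbary hy₁ hy₁' hy₂ hy₂'
  -- block sectors
  obtain ⟨kx₁, hkx₁⟩ : ∃ q : ℕ, halfRectN (2 * x₁) M = q := ⟨_, rfl⟩
  obtain ⟨ky₁, hky₁⟩ : ∃ q : ℕ, halfRectN (2 * y₁) M = q := ⟨_, rfl⟩
  obtain ⟨kx₂, hkx₂⟩ : ∃ q : ℕ, halfRectN (2 * x₂) M = q := ⟨_, rfl⟩
  obtain ⟨ky₂, hky₂⟩ : ∃ q : ℕ, halfRectN (2 * y₂) M = q := ⟨_, rfl⟩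
  obtain ⟨kz, hkz⟩ : ∃ q : ℕ, halfRectN (2 * Z) ((k + 1) * M) = q := ⟨_, rfl⟩
  obtain ⟨kw, hkw⟩ : ∃ q : ℕ, halfRectN (2 * W) ((k + 1) * M) = q := ⟨_, rfl⟩
  have hlt : ∀ {u : ℝ} {q : ℕ}, 0 ≤ u → u < 1 → halfRectN (2 * u) M = q → q < M * M := by
    intro u q hu hu' h; rw [← h]; exact halfRectN_lt_sq (by linarith) (by linarith) hM
  have hkx₁M := hlt hx₁ hx₁' hkx₁
  have hky₁M := hlt hy₁ hy₁' hky₁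
  have hkx₂M := hlt hx₂ hx₂' hkx₂
  have hky₂M := hlt hy₂ hy₂' hky₂
  have hle : ∀ {u : ℝ} {q : ℕ}, 0 ≤ u → halfRectN (2 * u) M = q → (q : ℝ) ≤ u * (M : ℝ) ^ 2 := by
    intro u q hu h; rw [← h]; have := halfRectN_real_le' (n := 2 * u) (by linarith) M; linarith
  have hgt : ∀ {u : ℝ} {q : ℕ}, halfRectN (2 * u) M = q → u * (M : ℝ) ^ 2 - 1 < q := by
    intro u q h; rw [← h]; have := halfRectN_real_gt' (2 * u) M; linarith
  have hkx₁_le := hle hx₁ hkx₁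
  have hky₁_le := hle hy₁ hky₁
  have hkx₂_le := hle hx₂ hkx₂
  have hky₂_le := hle hy₂ hky₂
  have hkx₁_gt := hgt hkx₁
  have hky₁_gt := hgt hky₁
  have hkx₂_gt := hgt hkx₂
  have hky₂_gt := hgt hky₂
  have hkz_le : (kz : ℝ) ≤ Z * ((((k + 1) * M : ℕ) : ℝ)) ^ 2 := by
    rw [← hkz]; have := halfRectN_real_le' (n := 2 * Z) (by linarith) ((k + 1) * M); linarith
  have hkw_le : (kw : ℝ) ≤ W * ((((k + 1) * M : ℕ) : ℝ)) ^ 2 := by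
    rw [← hkw]; have := halfRectN_real_le' (n := 2 * W) (by linarith) ((k + 1) * M); linarith
  have hKM1 : 1 ≤ (k + 1) * M := Nat.mul_pos (Nat.succ_pos k) hM
  have hkzM : kz < (k + 1) * M * ((k + 1) * M) := by
    rw [← hkz]; exact halfRectN_lt_sq (by linarith) (by linarith) hKM1
  have hkwM : kw < (k + 1) * M * ((k + 1) * M) := by
    rw [← hkw]; exact halfRectN_lt_sq (by linarith) (by linarith) hKM1
  -- the block pattern
  obtain ⟨ps, hps⟩ : ∃ ps : Fin (k + 1) → Fin (k + 1) → ℕ,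
      ps = fun (i : Fin (k + 1)) (_ : Fin (k + 1)) => if (i : ℕ) < a then kx₁ else kx₂ := ⟨_, rfl⟩
  obtain ⟨qs, hqs⟩ : ∃ qs : Fin (k + 1) → Fin (k + 1) → ℕ,
      qs = fun (i : Fin (k + 1)) (_ : Fin (k + 1)) => if (i : ℕ) < a then ky₁ else ky₂ := ⟨_, rfl⟩
  have hps_apply : ∀ i j, ps i j = if (i : ℕ) < a then kx₁ else kx₂ := fun i j => by rw [hps]
  have hqs_apply : ∀ i j, qs i j = if (i : ℕ) < a then ky₁ else ky₂ := fun i j => by rw [hqs]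
  have hps_le : ∀ i j, ps i j ≤ M * M := by
    intro i j; rw [hps_apply]; split_ifs
    · exact hkx₁M.le
    · exact hkx₂M.le
  have hqs_le : ∀ i j, qs i j ≤ M * M := by
    intro i j; rw [hqs_apply]; split_ifs
    · exact hky₁M.le
    · exact hky₂M.le
  have hsumP : ∑ i : Fin (k + 1), ∑ j : Fin (k + 1), ps i j = (k + 1) * (a * kx₁ + (k + 1 - a) * kx₂) := by
    simp only [hps_apply, Finset.sum_const, Finset.card_univ, Fintype.card_fin, smul_eq_mul]
    rw [← Finset.mul_sum, sum_fin_ite_lt_of_le' (k + 1) a ha, smul_eq_mul, smul_eq_mul]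
  have hsumQ : ∑ i : Fin (k + 1), ∑ j : Fin (k + 1), qs i j = (k + 1) * (a * ky₁ + (k + 1 - a) * ky₂) := by
    simp only [hqs_apply, Finset.sum_const, Finset.card_univ, Fintype.card_fin, smul_eq_mul]
    rw [← Finset.mul_sum, sum_fin_ite_lt_of_le' (k + 1) a ha, smul_eq_mul, smul_eq_mul]
  obtain ⟨S, hS⟩ : ∃ S : ℕ, (k + 1) * (a * kx₁ + (k + 1 - a) * kx₂) = S := ⟨_, rfl⟩
  obtain ⟨T, hT⟩ : ∃ T : ℕ, (k + 1) * (a * ky₁ + (k + 1 - a) * ky₂) = T := ⟨_, rfl⟩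
  -- positivity of the partition functions involved
  have hHM := hubbardRectTorusTT'_isHermitian M M t t' U
  have hZpos : ∀ q q' : ℕ, q ≤ M * M → q' ≤ M * M →
      0 < (partitionFn β (spinSectorHamiltonian q q' (hubbardRectTorusTT' M M t t' U))).re := by
    intro q q' hq hq'
    have hq1 : q ≤ Fintype.card (Fin M ×ₗ Fin M) := by rw [card_rectSites]; exact hq
    have hq1' : q' ≤ Fintype.card (Fin M ×ₗ Fin M) := by rw [card_rectSites]; exact hq'
    haveI := nonempty_spinConfig (Λ := Fin M ×ₗ Fin M) hq1 hq1'
    exact partitionFn_spinSector_re_pos hHM β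
  -- the tiling inequality and its logarithm
  have htile := prod_partitionFn_hubbardRectTorusTT'_squares_le M t t' U hβ k ps qs
  rw [hsumP, hsumQ, hS, hT] at htile
  have hprodpos : 0 < ∏ i : Fin (k + 1), ∏ j : Fin (k + 1),
      (partitionFn β (spinSectorHamiltonian (ps i j) (qs i j) (hubbardRectTorusTT' M M t t' U))).re :=
    Finset.prod_pos fun i _ => Finset.prod_pos fun j _ => hZpos _ _ (hps_le i j) (hqs_le i j)
  have hlogtile : -(β * ((16 * |t| + 32 * |t'|) * M * k * (k + 1))) +
      ∑ i : Fin (k + 1), ∑ j : Fin (k + 1),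
        Real.log (partitionFn β (spinSectorHamiltonian (ps i j) (qs i j) (hubbardRectTorusTT' M M t t' U))).re ≤
      Real.log (partitionFn β (spinSectorHamiltonian S T
        (hubbardRectTorusTT' ((k + 1) * M) ((k + 1) * M) t t' U))).re := by
    have h := Real.log_le_log (mul_pos (Real.exp_pos _) hprodpos) htile
    rw [Real.log_mul (Real.exp_pos _).ne' hprodpos.ne', Real.log_exp,
      Real.log_prod (fun i _ => (Finset.prod_pos fun j _ => hZpos _ _ (hps_le i j) (hqs_le i j)).ne')] at h
    have e : ∀ i : Fin (k + 1), Real.log (∏ j : Fin (k + 1),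
        (partitionFn β (spinSectorHamiltonian (ps i j) (qs i j) (hubbardRectTorusTT' M M t t' U))).re) =
        ∑ j : Fin (k + 1), Real.log (partitionFn β (spinSectorHamiltonian (ps i j) (qs i j)
          (hubbardRectTorusTT' M M t t' U))).re :=
      fun i => Real.log_prod (fun j _ => (hZpos _ _ (hps_le i j) (hqs_le i j)).ne')
    simp only [e] at h
    exact h
  clear htile hprodpos
  have hsumE : ∑ i : Fin (k + 1), ∑ _j : Fin (k + 1),
      Real.log (partitionFn β (spinSectorHamiltonian (ps i _j) (qs i _j) (hubbardRectTorusTT' M M t t' U))).re =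
      ((k + 1 : ℕ) : ℝ) * (a * Real.log (partitionFn β (spinSectorHamiltonian kx₁ ky₁
          (hubbardRectTorusTT' M M t t' U))).re +
        (((k + 1 : ℕ) : ℝ) - a) *
          Real.log (partitionFn β (spinSectorHamiltonian kx₂ ky₂ (hubbardRectTorusTT' M M t t' U))).re) := by
    have e2 : ∀ i j : Fin (k + 1), Real.log (partitionFn β (spinSectorHamiltonian (ps i j) (qs i j)
        (hubbardRectTorusTT' M M t t' U))).re =
        if (i : ℕ) < a then Real.log (partitionFn β (spinSectorHamiltonian kx₁ ky₁
          (hubbardRectTorusTT' M M t t' U))).re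
        else Real.log (partitionFn β (spinSectorHamiltonian kx₂ ky₂ (hubbardRectTorusTT' M M t t' U))).re :=
      fun i j => by
        by_cases hi : (i : ℕ) < a
        · rw [if_pos hi, hps_apply, hqs_apply, if_pos hi, if_pos hi]
        · rw [if_neg hi, hps_apply, hqs_apply, if_neg hi, if_neg hi]
    simp only [e2, Finset.sum_const, Finset.card_univ, Fintype.card_fin, nsmul_eq_mul]
    rw [← Finset.mul_sum, sum_fin_ite_lt_of_le' (k + 1) a ha, nsmul_eq_mul, nsmul_eq_mul, Nat.cast_sub ha]
  rw [hsumE] at hlogtile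
  -- the rounding electrons: `S ≤ kz ≤ S + K²`, `T ≤ kw ≤ T + K²`
  have hbaryM : ∀ {u v Zb : ℝ}, Zb = (a * u + ((k + 1 : ℕ) - a) * v) / (k + 1 : ℕ) →
      Zb * ((((k + 1) * M : ℕ) : ℝ)) ^ 2 =
        (k + 1 : ℕ) * (a * (u * (M : ℝ) ^ 2) + (((k + 1 : ℕ) : ℝ) - a) * (v * (M : ℝ) ^ 2)) := by
    intro u v Zb h; rw [h]; push_cast; field_simp
  have hZKM := hbaryM (u := x₁) (v := x₂) hZdef
  have hWKM := hbaryM (u := y₁) (v := y₂) hWdef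
  have hSR : ((S : ℕ) : ℝ) = (k + 1 : ℕ) * (a * (kx₁ : ℝ) + (((k + 1 : ℕ) : ℝ) - a) * kx₂) := by
    rw [← hS]; push_cast [Nat.cast_sub ha]; ring
  have hTR : ((T : ℕ) : ℝ) = (k + 1 : ℕ) * (a * (ky₁ : ℝ) + (((k + 1 : ℕ) : ℝ) - a) * ky₂) := by
    rw [← hT]; push_cast [Nat.cast_sub ha]; ring
  have hround : ∀ {u v Zb : ℝ} {q₁ q₂ R kb : ℕ}, 0 ≤ Zb →
      Zb * ((((k + 1) * M : ℕ) : ℝ)) ^ 2 =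
        (k + 1 : ℕ) * (a * (u * (M : ℝ) ^ 2) + (((k + 1 : ℕ) : ℝ) - a) * (v * (M : ℝ) ^ 2)) →
      ((R : ℕ) : ℝ) = (k + 1 : ℕ) * (a * (q₁ : ℝ) + (((k + 1 : ℕ) : ℝ) - a) * q₂) →
      (q₁ : ℝ) ≤ u * (M : ℝ) ^ 2 → (q₂ : ℝ) ≤ v * (M : ℝ) ^ 2 → u * (M : ℝ) ^ 2 - 1 < q₁ → v * (M : ℝ) ^ 2 - 1 < q₂ →
      halfRectN (2 * Zb) ((k + 1) * M) = kb → (kb : ℝ) ≤ Zb * ((((k + 1) * M : ℕ) : ℝ)) ^ 2 →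
      R ≤ kb ∧ ((kb : ℝ)) - R ≤ ((k + 1 : ℕ) : ℝ) ^ 2 := by
    intro u v Zb q₁ q₂ R kb hZb0 hZbKM hRR hq₁ hq₂ hq₁' hq₂' hkb hkb_le
    have hRle : R ≤ kb := by
      rw [← hkb, halfRectN]
      refine Nat.le_floor ?_
      have e1 : 2 * Zb * ((((k + 1) * M : ℕ) : ℝ)) ^ 2 / 2 = Zb * ((((k + 1) * M : ℕ) : ℝ)) ^ 2 := by ring
      rw [e1, hZbKM, hRR]
      refine mul_le_mul_of_nonneg_left ?_ hKpos.le
      exact add_le_add (mul_le_mul_of_nonneg_left hq₁ ha0) (mul_le_mul_of_nonneg_left hq₂ hKa)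
    refine ⟨hRle, ?_⟩
    rw [hZbKM] at hkb_le
    rw [hRR]
    have i1 : ((k + 1 : ℕ) : ℝ) * (a * (u * (M : ℝ) ^ 2 - 1)) ≤ ((k + 1 : ℕ) : ℝ) * (a * q₁) :=
      mul_le_mul_of_nonneg_left (mul_le_mul_of_nonneg_left hq₁'.le ha0) hKpos.le
    have i2 : ((k + 1 : ℕ) : ℝ) * ((((k + 1 : ℕ) : ℝ) - a) * (v * (M : ℝ) ^ 2 - 1)) ≤
        ((k + 1 : ℕ) : ℝ) * ((((k + 1 : ℕ) : ℝ) - a) * q₂) :=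
      mul_le_mul_of_nonneg_left (mul_le_mul_of_nonneg_left hq₂'.le hKa) hKpos.le
    nlinarith only [i1, i2, hkb_le]
  obtain ⟨hSkz, hdz⟩ := hround hZ0 hZKM hSR hkx₁_le hkx₂_le hkx₁_gt hkx₂_gt hkz hkz_le
  obtain ⟨hTkw, hdw⟩ := hround hW0 hWKM hTR hky₁_le hky₂_le hky₁_gt hky₂_gt hkw hkw_le
  obtain ⟨dz, hdzdef⟩ : ∃ d, kz = S + d := ⟨_, (Nat.add_sub_cancel' hSkz).symm⟩
  obtain ⟨dw, hdwdef⟩ : ∃ d, kw = T + d := ⟨_, (Nat.add_sub_cancel' hTkw).symm⟩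
  have hdzR : (dz : ℝ) ≤ ((k + 1 : ℕ) : ℝ) ^ 2 := by
    have : (kz : ℝ) = S + dz := by rw [hdzdef]; push_cast; ring
    linarith
  have hdwR : (dw : ℝ) ≤ ((k + 1 : ℕ) : ℝ) ^ 2 := by
    have : (kw : ℝ) = T + dw := by rw [hdwdef]; push_cast; ring
    linarith
  -- the rounding price: up electrons `(S,T) → (kz,T)`, then down electrons `(kz,T) → (kz,kw)`
  have hKM1' : 1 ≤ (k + 1) * M * ((k + 1) * M) := Nat.mul_pos hKM1 hKM1
  have hTle : T ≤ (k + 1) * M * ((k + 1) * M) := hTkw.trans hkwM.le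
  have hup := log_partitionFn_up_steps_ge t t' U hβ ((k + 1) * M) ((k + 1) * M) hKM1' hTle dz S
    (by rw [← hdzdef]; exact hkzM.le)
  have hdown := log_partitionFn_down_steps_ge t t' U hβ ((k + 1) * M) ((k + 1) * M) hKM1' (k := kz) hkzM.le dw T
    (by rw [← hdwdef]; exact hkwM.le)
  rw [← hdzdef, hκ] at hup
  rw [← hdwdef, hκ] at hdown
  -- `log|Λ| ≤ 2KM` and the total rounding budget `2K²(2KM + κ)`
  have hKMR : ((((k + 1) * M : ℕ) : ℝ)) = ((k + 1 : ℕ) : ℝ) * M := by push_cast; ring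
  have hlogV : Real.log ((((k + 1) * M * ((k + 1) * M) : ℕ) : ℝ)) ≤ 2 * (((k + 1 : ℕ) : ℝ) * M) := by
    have hKMpos : (0 : ℝ) < ((k + 1 : ℕ) : ℝ) * M := by positivity
    have e : ((((k + 1) * M * ((k + 1) * M) : ℕ) : ℝ)) = (((k + 1 : ℕ) : ℝ) * M) ^ 2 := by push_cast; ring
    rw [e, Real.log_pow, Nat.cast_ofNat]
    have := Real.log_le_sub_one_of_pos hKMpos
    linarith
  have hroundR : -(2 * ((k + 1 : ℕ) : ℝ) ^ 2 * (2 * (((k + 1 : ℕ) : ℝ) * M) + κ)) ≤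
      Real.log (partitionFn β (spinSectorHamiltonian kz kw
          (hubbardRectTorusTT' ((k + 1) * M) ((k + 1) * M) t t' U))).re -
        Real.log (partitionFn β (spinSectorHamiltonian S T
          (hubbardRectTorusTT' ((k + 1) * M) ((k + 1) * M) t t' U))).re := by
    have hlog0 : 0 ≤ Real.log ((((k + 1) * M * ((k + 1) * M) : ℕ) : ℝ)) :=
      Real.log_nonneg (by exact_mod_cast hKM1')
    have h1 : (dz : ℝ) * (Real.log ((((k + 1) * M * ((k + 1) * M) : ℕ) : ℝ)) + κ) ≤
        ((k + 1 : ℕ) : ℝ) ^ 2 * (2 * (((k + 1 : ℕ) : ℝ) * M) + κ) :=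
      mul_le_mul hdzR (add_le_add hlogV (le_refl κ)) (by positivity) (by positivity)
    have h2 : (dw : ℝ) * (Real.log ((((k + 1) * M * ((k + 1) * M) : ℕ) : ℝ)) + κ) ≤
        ((k + 1 : ℕ) : ℝ) ^ 2 * (2 * (((k + 1 : ℕ) : ℝ) * M) + κ) :=
      mul_le_mul hdwR (add_le_add hlogV (le_refl κ)) (by positivity) (by positivity)
    generalize Real.log (partitionFn β (spinSectorHamiltonian kz kw
        (hubbardRectTorusTT' ((k + 1) * M) ((k + 1) * M) t t' U))).re = A₁ at hdown ⊢
    generalize Real.log (partitionFn β (spinSectorHamiltonian S T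
        (hubbardRectTorusTT' ((k + 1) * M) ((k + 1) * M) t t' U))).re = A₂ at hup ⊢
    generalize Real.log (partitionFn β (spinSectorHamiltonian kz T
        (hubbardRectTorusTT' ((k + 1) * M) ((k + 1) * M) t t' U))).re = A₃ at hup hdown
    linarith [hup, hdown, h1, h2]
  -- assemble and divide by `(KM)²`
  have hKM2 : (0 : ℝ) < ((((k + 1) * M : ℕ) : ℝ)) ^ 2 := by positivity
  have epM : ∀ (u v : ℝ) (q q' : ℕ), halfRectN (2 * u) M = q → halfRectN (2 * v) M = q' →
      spinSectorPressureTT' β t t' U u v M =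
        Real.log (partitionFn β (spinSectorHamiltonian q q' (hubbardRectTorusTT' M M t t' U))).re / (M : ℝ) ^ 2 := by
    intro u v q q' h h'; rw [spinSectorPressureTT', h, h']
  rw [epM x₁ y₁ kx₁ ky₁ hkx₁ hky₁, epM x₂ y₂ kx₂ ky₂ hkx₂ hky₂, spinSectorPressureTT', hkz, hkw, le_div_iff₀ hKM2]
  -- opaque atoms for the four partition functions
  generalize Real.log (partitionFn β (spinSectorHamiltonian kx₁ ky₁ (hubbardRectTorusTT' M M t t' U))).re = P₁
    at hlogtile ⊢
  generalize Real.log (partitionFn β (spinSectorHamiltonian kx₂ ky₂ (hubbardRectTorusTT' M M t t' U))).re = P₂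
    at hlogtile ⊢
  generalize Real.log (partitionFn β (spinSectorHamiltonian S T
      (hubbardRectTorusTT' ((k + 1) * M) ((k + 1) * M) t t' U))).re = Q₁ at hlogtile hroundR
  generalize Real.log (partitionFn β (spinSectorHamiltonian kz kw
      (hubbardRectTorusTT' ((k + 1) * M) ((k + 1) * M) t t' U))).re = Q₂ at hroundR ⊢
  have hkK : (k : ℝ) * ((k : ℝ) + 1) ≤ ((k + 1 : ℕ) : ℝ) ^ 2 := by
    push_cast; linarith only [Nat.cast_nonneg (α := ℝ) k]
  rw [hKMR, rows_div_identity hKpos.ne' hMpos.ne']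
  have hc0 : (0 : ℝ) ≤ 16 * |t| + 32 * |t'| := by positivity
  exact rows_final_arith hlogtile hroundR hkK (mul_nonneg hβ hc0) hMpos.le

end Tiling

/-! ### §3 Joint concavity and `S^z = 0` dominance -/

/-- Points of a segment between two points of `[0,1)` stay in `[0,1)`. [folklore] -/
private theorem segment_mem_Ico' {x₁ x₂ s : ℝ} (hx₁ : x₁ ∈ Set.Ico (0 : ℝ) 1) (hx₂ : x₂ ∈ Set.Ico (0 : ℝ) 1)
    (hs0 : 0 ≤ s) (hs1 : s ≤ 1) : s * x₁ + (1 - s) * x₂ ∈ Set.Ico (0 : ℝ) 1 := by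
  have h1s : 0 ≤ 1 - s := by linarith
  refine ⟨by nlinarith [hx₁.1, hx₂.1], ?_⟩
  have : s * x₁ + (1 - s) * x₂ ≤ s * max x₁ x₂ + (1 - s) * max x₁ x₂ :=
    add_le_add (mul_le_mul_of_nonneg_left (le_max_left _ _) hs0) (mul_le_mul_of_nonneg_left (le_max_right _ _) h1s)
  have hm : max x₁ x₂ < 1 := max_lt hx₁.2 hx₂.2
  nlinarith

/-- Dyadic-free rational approximation: `⌊θ(k+1)⌋/(k+1) → θ` inside `[0,1]`. [folklore] -/
private theorem tendsto_floor_div (θ : ℝ) (hθ : 0 ≤ θ) :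
    Tendsto (fun k : ℕ => (⌊θ * (k + 1 : ℕ)⌋₊ : ℝ) / (k + 1 : ℕ)) atTop (𝓝 θ) := by
  rw [Metric.tendsto_atTop]
  intro ε hε
  obtain ⟨N, hN⟩ := exists_nat_gt (1 / ε)
  refine ⟨N, fun k hk => ?_⟩
  have hKpos : (0 : ℝ) < (k + 1 : ℕ) := by positivity
  have h1 : (⌊θ * (k + 1 : ℕ)⌋₊ : ℝ) ≤ θ * (k + 1 : ℕ) := Nat.floor_le (by positivity)
  have h2 : θ * (k + 1 : ℕ) < ⌊θ * (k + 1 : ℕ)⌋₊ + 1 := Nat.lt_floor_add_one _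
  have e : (⌊θ * (k + 1 : ℕ)⌋₊ : ℝ) / (k + 1 : ℕ) - θ = ((⌊θ * (k + 1 : ℕ)⌋₊ : ℝ) - θ * (k + 1 : ℕ)) / (k + 1 : ℕ) := by
    field_simp
  rw [Real.dist_eq, e, abs_div, abs_of_pos hKpos, div_lt_iff₀ hKpos]
  have hk1 : (1 : ℝ) / ε < (k + 1 : ℕ) := by
    have : (N : ℝ) ≤ k := by exact_mod_cast hk
    push_cast; linarith
  rw [div_lt_iff₀ hε] at hk1
  rw [abs_lt]
  constructor <;> nlinarith

section Concave

variable {β : ℝ} (hβ : 0 ≤ β) (t t' : ℝ) {U : ℝ} (hU : 0 ≤ U)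
include hβ hU

/-- **Joint concavity at rational weights.** For `(x₁,y₁), (x₂,y₂) ∈ [0,1)²`, `K = k+1`, `a ≤ K`:
`(a/K) p(x₁,y₁) + ((K−a)/K) p(x₂,y₂) ≤ p((a x₁ + (K−a) x₂)/K, (a y₁ + (K−a) y₂)/K)`. [cite: Ruelle1969, §3.4] -/
theorem pressureTT'₂_ratConcave {x₁ y₁ x₂ y₂ : ℝ} (hx₁ : 0 ≤ x₁) (hx₁' : x₁ < 1) (hy₁ : 0 ≤ y₁) (hy₁' : y₁ < 1)
    (hx₂ : 0 ≤ x₂) (hx₂' : x₂ < 1) (hy₂ : 0 ≤ y₂) (hy₂' : y₂ < 1) (k a : ℕ) (ha : a ≤ k + 1) :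
    (a / (k + 1 : ℕ)) * pressureTT'₂ β t t' U x₁ y₁ + (((k + 1 : ℕ) - a) / (k + 1 : ℕ)) * pressureTT'₂ β t t' U x₂ y₂ ≤
      pressureTT'₂ β t t' U ((a * x₁ + ((k + 1 : ℕ) - a) * x₂) / (k + 1 : ℕ))
        ((a * y₁ + ((k + 1 : ℕ) - a) * y₂) / (k + 1 : ℕ)) := by
  have hKpos : (0 : ℝ) < (k + 1 : ℕ) := by positivity
  have haK : (a : ℝ) ≤ (k + 1 : ℕ) := by exact_mod_cast ha
  have hKa : (0 : ℝ) ≤ ((k + 1 : ℕ) : ℝ) - a := by linarith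
  have ha0 : (0 : ℝ) ≤ a := Nat.cast_nonneg a
  have hbary : ∀ {u v : ℝ}, 0 ≤ u → u < 1 → 0 ≤ v → v < 1 →
      0 ≤ (a * u + ((k + 1 : ℕ) - a) * v) / (k + 1 : ℕ) ∧ (a * u + ((k + 1 : ℕ) - a) * v) / (k + 1 : ℕ) < 1 := by
    intro u v hu hu' hv hv'
    constructor
    · apply div_nonneg _ hKpos.le
      have : 0 ≤ (((k + 1 : ℕ) : ℝ) - a) * v := mul_nonneg hKa hv
      positivity
    · rw [div_lt_iff₀ hKpos]
      have h1 : (a : ℝ) * u ≤ a * max u v := mul_le_mul_of_nonneg_left (le_max_left _ _) ha0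
      have h2 : (((k + 1 : ℕ) : ℝ) - a) * v ≤ (((k + 1 : ℕ) : ℝ) - a) * max u v :=
        mul_le_mul_of_nonneg_left (le_max_right _ _) hKa
      have : max u v < 1 := max_lt hu' hv'
      nlinarith
  obtain ⟨hZ0, hZ1⟩ := hbary hx₁ hx₁' hx₂ hx₂'
  obtain ⟨hW0, hW1⟩ := hbary hy₁ hy₁' hy₂ hy₂'
  set E₁ : ℝ := β * (16 * |t| + 32 * |t'|) + 4 * (k + 1 : ℕ) with hE₁
  set E₂ : ℝ := 2 * (β * (4 * |t| + 4 * |t'| + max U 0)) with hE₂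
  have hf := (tendsto_spinSectorPressureTT' hβ t t' hU hZ0 hZ1 hW0 hW1).comp
    (tendsto_atTop_mono (fun M : ℕ => Nat.le_mul_of_pos_left M (Nat.succ_pos k)) tendsto_id)
  have hE2lim : Tendsto (fun M : ℕ => E₂ / (M : ℝ) ^ 2) atTop (𝓝 0) := by
    have h := (tendsto_const_div_atTop_nhds_zero_nat E₂).comp (tendsto_pow_atTop (n := 2) two_ne_zero)
    refine h.congr fun M => ?_
    simp
  have hg : Tendsto (fun M : ℕ => (a / (k + 1 : ℕ)) * spinSectorPressureTT' β t t' U x₁ y₁ M +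
      (((k + 1 : ℕ) - a) / (k + 1 : ℕ)) * spinSectorPressureTT' β t t' U x₂ y₂ M - E₁ / M - E₂ / (M : ℝ) ^ 2) atTop
      (𝓝 ((a / (k + 1 : ℕ)) * pressureTT'₂ β t t' U x₁ y₁ +
        (((k + 1 : ℕ) - a) / (k + 1 : ℕ)) * pressureTT'₂ β t t' U x₂ y₂ - 0 - 0)) :=
    (((tendsto_const_nhds.mul (tendsto_spinSectorPressureTT' hβ t t' hU hx₁ hx₁' hy₁ hy₁')).add
      (tendsto_const_nhds.mul (tendsto_spinSectorPressureTT' hβ t t' hU hx₂ hx₂' hy₂ hy₂'))).sub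
      (tendsto_const_div_atTop_nhds_zero_nat E₁)).sub hE2lim
  rw [sub_zero, sub_zero] at hg
  refine le_of_tendsto_of_tendsto hg hf (eventually_atTop.2 ⟨1, fun M hM => ?_⟩)
  have h := spinSectorPressureTT'_rows_le t t' U hβ hx₁ hx₁' hy₁ hy₁' hx₂ hx₂' hy₂ hy₂' k a ha hM
  rw [← hE₁, ← hE₂] at h
  exact h

/-- **Midpoint concavity**: `(p(x₁,y₁) + p(x₂,y₂))/2 ≤ p((x₁+x₂)/2, (y₁+y₂)/2)`. [cite: Ruelle1969, §3.4] -/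
theorem pressureTT'₂_midpoint {x₁ y₁ x₂ y₂ : ℝ} (hx₁ : 0 ≤ x₁) (hx₁' : x₁ < 1) (hy₁ : 0 ≤ y₁) (hy₁' : y₁ < 1)
    (hx₂ : 0 ≤ x₂) (hx₂' : x₂ < 1) (hy₂ : 0 ≤ y₂) (hy₂' : y₂ < 1) :
    (pressureTT'₂ β t t' U x₁ y₁ + pressureTT'₂ β t t' U x₂ y₂) / 2 ≤
      pressureTT'₂ β t t' U ((x₁ + x₂) / 2) ((y₁ + y₂) / 2) := by
  have h := pressureTT'₂_ratConcave hβ t t' hU hx₁ hx₁' hy₁ hy₁' hx₂ hx₂' hy₂ hy₂' 1 1 (by norm_num)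
  have e1 : ((1 : ℕ) : ℝ) / ((1 + 1 : ℕ) : ℝ) = 1 / 2 := by norm_num
  have e2 : (((1 + 1 : ℕ) : ℝ) - (1 : ℕ)) / ((1 + 1 : ℕ) : ℝ) = 1 / 2 := by norm_num
  have e3 : ∀ u v : ℝ, ((1 : ℕ) * u + (((1 + 1 : ℕ) : ℝ) - (1 : ℕ)) * v) / ((1 + 1 : ℕ) : ℝ) = (u + v) / 2 := by
    intro u v; push_cast; ring
  rw [e1, e2, e3, e3] at h
  linarith

/-- **`S^z = 0` dominance**: `p(x, y) ≤ p((x+y)/2, (x+y)/2)` — at a given filling, the unpolarised sector has the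
largest free entropy (midpoint concavity between `(x,y)` and its spin flip `(y,x)`).
[cite: LiebPRL1989, proof of Theorem 1] [cite: Ruelle1969, §3.4] -/
theorem pressureTT'₂_le_diag {x y : ℝ} (hx0 : 0 ≤ x) (hx1 : x < 1) (hy0 : 0 ≤ y) (hy1 : y < 1) :
    pressureTT'₂ β t t' U x y ≤ pressureTT'₂ β t t' U ((x + y) / 2) ((x + y) / 2) := by
  have h := pressureTT'₂_midpoint hβ t t' hU hx0 hx1 hy0 hy1 hy0 hy1 hx0 hx1
  rw [pressureTT'₂_swap hβ t t' hU hy0 hy1 hx0 hx1, show (y + x) / 2 = (x + y) / 2 by ring] at h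
  linarith

/-- **The canonical `S^z = 0` pressure of record dominates every spin sector of the same filling**:
`p(β; t,t',U; x, y) ≤ pressureTT' β t t' U (x + y)` for `x, y ∈ [0,1)`. [cite: LiebPRL1989, proof of Theorem 1] -/
theorem pressureTT'₂_le_pressureTT' {x y : ℝ} (hx0 : 0 ≤ x) (hx1 : x < 1) (hy0 : 0 ≤ y) (hy1 : y < 1) :
    pressureTT'₂ β t t' U x y ≤ pressureTT' β t t' U (x + y) := by
  have h := pressureTT'₂_le_diag hβ t t' hU hx0 hx1 hy0 hy1
  rwa [pressureTT'₂_half_half hβ t t' hU (by linarith) (by linarith)] at h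

/-- **Joint continuity modulus**: `|p(x',y') − p(x,y)| ≤ |H_b(x') − H_b(x)| + |H_b(y') − H_b(y)| +
β(4|t|+4|t'|+U)(|x'−x| + |y'−y|)` on `[0,1)²` (the two density legs). [cite: Ruelle1969, §3.4] -/
theorem abs_pressureTT'₂_sub_le {x y x' y' : ℝ} (hx0 : 0 ≤ x) (hx1 : x < 1) (hy0 : 0 ≤ y) (hy1 : y < 1)
    (hx'0 : 0 ≤ x') (hx'1 : x' < 1) (hy'0 : 0 ≤ y') (hy'1 : y' < 1) :
    |pressureTT'₂ β t t' U x' y' - pressureTT'₂ β t t' U x y| ≤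
      |Real.binEntropy x' - Real.binEntropy x| + |Real.binEntropy y' - Real.binEntropy y| +
        β * (4 * |t| + 4 * |t'| + U) * (|x' - x| + |y' - y|) := by
  have hκ0 : 0 ≤ β * (4 * |t| + 4 * |t'| + U) := by positivity
  have hw : β * (4 * |t| + 4 * |t'|) ≤ β * (4 * |t| + 4 * |t'| + U) := mul_le_mul_of_nonneg_left (by linarith) hβ
  -- first leg: `(x, y) → (x', y)`
  have h1 : |(pressureTT'₂ β t t' U x' y - Real.binEntropy x') - (pressureTT'₂ β t t' U x y - Real.binEntropy x)| ≤
      β * (4 * |t| + 4 * |t'| + U) * |x' - x| := by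
    rcases le_total x x' with h | h
    · obtain ⟨a1, a2⟩ := pressureTT'₂_sub_binEntropy_sub_mem_fst hβ t t' hU hx0 h hx'1 hy0 hy1
      rw [abs_of_nonneg (sub_nonneg.2 h), abs_le]
      constructor
      · linarith
      · exact a2.trans (mul_le_mul_of_nonneg_right hw (sub_nonneg.2 h))
    · obtain ⟨a1, a2⟩ := pressureTT'₂_sub_binEntropy_sub_mem_fst hβ t t' hU hx'0 h hx1 hy0 hy1
      rw [abs_of_nonpos (sub_nonpos.2 h), abs_le]
      have := a2.trans (mul_le_mul_of_nonneg_right hw (sub_nonneg.2 h))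
      constructor <;> linarith
  -- second leg: `(x', y) → (x', y')`
  have h2 : |(pressureTT'₂ β t t' U x' y' - Real.binEntropy y') - (pressureTT'₂ β t t' U x' y - Real.binEntropy y)| ≤
      β * (4 * |t| + 4 * |t'| + U) * |y' - y| := by
    rcases le_total y y' with h | h
    · obtain ⟨a1, a2⟩ := pressureTT'₂_sub_binEntropy_sub_mem_snd hβ t t' hU hx'0 hx'1 hy0 h hy'1
      rw [abs_of_nonneg (sub_nonneg.2 h), abs_le]
      constructor
      · linarith
      · exact a2.trans (mul_le_mul_of_nonneg_right hw (sub_nonneg.2 h))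
    · obtain ⟨a1, a2⟩ := pressureTT'₂_sub_binEntropy_sub_mem_snd hβ t t' hU hx'0 hx'1 hy'0 h hy1
      rw [abs_of_nonpos (sub_nonpos.2 h), abs_le]
      have := a2.trans (mul_le_mul_of_nonneg_right hw (sub_nonneg.2 h))
      constructor <;> linarith
  rw [abs_le] at h1 h2 ⊢
  have e1 := neg_abs_le (Real.binEntropy x' - Real.binEntropy x)
  have e2 := le_abs_self (Real.binEntropy x' - Real.binEntropy x)
  have e3 := neg_abs_le (Real.binEntropy y' - Real.binEntropy y)
  have e4 := le_abs_self (Real.binEntropy y' - Real.binEntropy y)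
  constructor <;> nlinarith [h1.1, h1.2, h2.1, h2.2, e1, e2, e3, e4, hκ0, abs_nonneg (x' - x), abs_nonneg (y' - y)]

/-- **Joint continuity** of `(x, y) ↦ p(β; t,t',U; x, y)` on `[0,1)²`. [cite: Ruelle1969, §3.4] -/
theorem continuousOn_pressureTT'₂ :
    ContinuousOn (fun z : ℝ × ℝ => pressureTT'₂ β t t' U z.1 z.2) (Set.Ico (0 : ℝ) 1 ×ˢ Set.Ico (0 : ℝ) 1) := by
  intro z hz
  obtain ⟨hx, hy⟩ := hz
  rw [Metric.continuousWithinAt_iff]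
  intro ε hε
  have hH := Real.binEntropy_continuous
  obtain ⟨δ₁, hδ₁, hδ₁'⟩ := Metric.continuous_iff.1 hH z.1 (ε / 4) (by positivity)
  obtain ⟨δ₂, hδ₂, hδ₂'⟩ := Metric.continuous_iff.1 hH z.2 (ε / 4) (by positivity)
  have hκ1 : 0 < β * (4 * |t| + 4 * |t'| + U) + 1 := by positivity
  refine ⟨min (min δ₁ δ₂) (ε / (4 * (β * (4 * |t| + 4 * |t'| + U) + 1))), by positivity, ?_⟩
  rintro w ⟨hwx, hwy⟩ hdist
  have hd1 : dist w.1 z.1 < min (min δ₁ δ₂) (ε / (4 * (β * (4 * |t| + 4 * |t'| + U) + 1))) :=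
    lt_of_le_of_lt (by rw [Prod.dist_eq]; exact le_max_left _ _) hdist
  have hd2 : dist w.2 z.2 < min (min δ₁ δ₂) (ε / (4 * (β * (4 * |t| + 4 * |t'| + U) + 1))) :=
    lt_of_le_of_lt (by rw [Prod.dist_eq]; exact le_max_right _ _) hdist
  have hδ1w : dist w.1 z.1 < δ₁ := lt_of_lt_of_le hd1 ((min_le_left _ _).trans (min_le_left _ _))
  have hδ2w : dist w.2 z.2 < δ₂ := lt_of_lt_of_le hd2 ((min_le_left _ _).trans (min_le_right _ _))
  have hη1 : dist w.1 z.1 < ε / (4 * (β * (4 * |t| + 4 * |t'| + U) + 1)) := lt_of_lt_of_le hd1 (min_le_right _ _)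
  have hη2 : dist w.2 z.2 < ε / (4 * (β * (4 * |t| + 4 * |t'| + U) + 1)) := lt_of_lt_of_le hd2 (min_le_right _ _)
  have hH1 := hδ₁' w.1 hδ1w
  have hH2 := hδ₂' w.2 hδ2w
  rw [Real.dist_eq] at hH1 hH2 hη1 hη2 ⊢
  have hmain := abs_pressureTT'₂_sub_le hβ t t' hU hx.1 hx.2 hy.1 hy.2 hwx.1 hwx.2 hwy.1 hwy.2
  have hsum : β * (4 * |t| + 4 * |t'| + U) * (|w.1 - z.1| + |w.2 - z.2|) ≤ ε / 2 := by
    have h1 : |w.1 - z.1| + |w.2 - z.2| ≤ 2 * (ε / (4 * (β * (4 * |t| + 4 * |t'| + U) + 1))) := by linarith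
    have h2 : β * (4 * |t| + 4 * |t'| + U) * (2 * (ε / (4 * (β * (4 * |t| + 4 * |t'| + U) + 1)))) ≤ ε / 2 := by
      rw [show β * (4 * |t| + 4 * |t'| + U) * (2 * (ε / (4 * (β * (4 * |t| + 4 * |t'| + U) + 1)))) =
          (β * (4 * |t| + 4 * |t'| + U)) / (β * (4 * |t| + 4 * |t'| + U) + 1) * (ε / 2) by
        field_simp; ring]
      have h3 : (β * (4 * |t| + 4 * |t'| + U)) / (β * (4 * |t| + 4 * |t'| + U) + 1) ≤ 1 := by
        rw [div_le_one hκ1]; linarith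
      have := mul_le_mul_of_nonneg_right h3 (by positivity : (0 : ℝ) ≤ ε / 2)
      linarith
    exact (mul_le_mul_of_nonneg_left h1 (by positivity)).trans h2
  linarith [hmain, hH1, hH2, hsum]

/-- Joint concavity at rational weights, `(1 − a/K)` form. [cite: Ruelle1969, §3.4] -/
theorem pressureTT'₂_ratConcave' {x₁ y₁ x₂ y₂ : ℝ} (hx₁ : x₁ ∈ Set.Ico (0 : ℝ) 1) (hy₁ : y₁ ∈ Set.Ico (0 : ℝ) 1)
    (hx₂ : x₂ ∈ Set.Ico (0 : ℝ) 1) (hy₂ : y₂ ∈ Set.Ico (0 : ℝ) 1) (k a : ℕ) (ha : a ≤ k + 1) :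
    ((a : ℝ) / (k + 1 : ℕ)) * pressureTT'₂ β t t' U x₁ y₁ + (1 - (a : ℝ) / (k + 1 : ℕ)) * pressureTT'₂ β t t' U x₂ y₂ ≤
      pressureTT'₂ β t t' U (((a : ℝ) / (k + 1 : ℕ)) * x₁ + (1 - (a : ℝ) / (k + 1 : ℕ)) * x₂)
        (((a : ℝ) / (k + 1 : ℕ)) * y₁ + (1 - (a : ℝ) / (k + 1 : ℕ)) * y₂) := by
  have hKpos : (0 : ℝ) < (k + 1 : ℕ) := by positivity
  have h := pressureTT'₂_ratConcave hβ t t' hU hx₁.1 hx₁.2 hy₁.1 hy₁.2 hx₂.1 hx₂.2 hy₂.1 hy₂.2 k a ha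
  have e1 : (((k + 1 : ℕ) : ℝ) - a) / (k + 1 : ℕ) = 1 - (a : ℝ) / (k + 1 : ℕ) := by field_simp
  have e2 : ∀ u v : ℝ, ((a : ℝ) * u + (((k + 1 : ℕ) : ℝ) - a) * v) / (k + 1 : ℕ) =
      (a : ℝ) / (k + 1 : ℕ) * u + (1 - (a : ℝ) / (k + 1 : ℕ)) * v := by
    intro u v; field_simp
  rw [e1, e2, e2] at h
  exact h

/-- Continuity of `p` along a segment of the square. [cite: Ruelle1969, §3.4] -/
theorem continuousOn_pressureTT'₂_segment {x₁ y₁ x₂ y₂ : ℝ} (hx₁ : x₁ ∈ Set.Ico (0 : ℝ) 1)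
    (hy₁ : y₁ ∈ Set.Ico (0 : ℝ) 1) (hx₂ : x₂ ∈ Set.Ico (0 : ℝ) 1) (hy₂ : y₂ ∈ Set.Ico (0 : ℝ) 1) :
    ContinuousOn (fun s : ℝ => pressureTT'₂ β t t' U (s * x₁ + (1 - s) * x₂) (s * y₁ + (1 - s) * y₂))
      (Set.Icc 0 1) := by
  have hcont : Continuous (fun s : ℝ => (s * x₁ + (1 - s) * x₂, s * y₁ + (1 - s) * y₂)) := by fun_prop
  have hseg' : Set.MapsTo (fun s : ℝ => (s * x₁ + (1 - s) * x₂, s * y₁ + (1 - s) * y₂)) (Set.Icc (0 : ℝ) 1)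
      (Set.Ico (0 : ℝ) 1 ×ˢ Set.Ico (0 : ℝ) 1) := fun s hs =>
    ⟨segment_mem_Ico' (x₁ := x₁) (x₂ := x₂) (s := s) hx₁ hx₂ hs.1 hs.2,
      segment_mem_Ico' (x₁ := y₁) (x₂ := y₂) (s := s) hy₁ hy₂ hs.1 hs.2⟩
  have h := ContinuousOn.comp (g := fun z : ℝ × ℝ => pressureTT'₂ β t t' U z.1 z.2)
    (f := fun s : ℝ => (s * x₁ + (1 - s) * x₂, s * y₁ + (1 - s) * y₂)) (s := Set.Icc (0 : ℝ) 1)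
    (continuousOn_pressureTT'₂ hβ t t' hU) hcont.continuousOn hseg'
  refine h.congr (fun s _ => ?_)
  simp only [Function.comp_apply]

/-- **Joint concavity along segments**: `θ p(z₁) + (1−θ) p(z₂) ≤ p(θ z₁ + (1−θ) z₂)` for `θ ∈ [0,1]` and
`z₁, z₂ ∈ [0,1)²` (rational weights by the mixed tiling, real weights by continuity). [cite: Ruelle1969, §3.4] -/
theorem pressureTT'₂_concave_comb {x₁ y₁ x₂ y₂ θ : ℝ} (hx₁ : x₁ ∈ Set.Ico (0 : ℝ) 1) (hy₁ : y₁ ∈ Set.Ico (0 : ℝ) 1)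
    (hx₂ : x₂ ∈ Set.Ico (0 : ℝ) 1) (hy₂ : y₂ ∈ Set.Ico (0 : ℝ) 1) (hθ0 : 0 ≤ θ) (hθ1 : θ ≤ 1) :
    θ * pressureTT'₂ β t t' U x₁ y₁ + (1 - θ) * pressureTT'₂ β t t' U x₂ y₂ ≤
      pressureTT'₂ β t t' U (θ * x₁ + (1 - θ) * x₂) (θ * y₁ + (1 - θ) * y₂) := by
  have hFc := continuousOn_pressureTT'₂_segment hβ t t' hU hx₁ hy₁ hx₂ hy₂
  have hGc : ContinuousOn (fun s : ℝ => s * pressureTT'₂ β t t' U x₁ y₁ + (1 - s) * pressureTT'₂ β t t' U x₂ y₂)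
      (Set.Icc 0 1) := Continuous.continuousOn (by fun_prop)
  -- the rational sequence `s_k = ⌊θ(k+1)⌋/(k+1) → θ` inside `[0,1]`
  have hsmem : ∀ k : ℕ, (⌊θ * (k + 1 : ℕ)⌋₊ : ℝ) / (k + 1 : ℕ) ∈ Set.Icc (0 : ℝ) 1 := by
    intro k
    have hKpos : (0 : ℝ) < (k + 1 : ℕ) := by positivity
    refine ⟨by positivity, ?_⟩
    rw [div_le_one hKpos]
    have h1 : (⌊θ * (k + 1 : ℕ)⌋₊ : ℝ) ≤ θ * (k + 1 : ℕ) := Nat.floor_le (by positivity)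
    nlinarith
  have hale : ∀ k : ℕ, ⌊θ * (k + 1 : ℕ)⌋₊ ≤ k + 1 := by
    intro k
    have hKpos : (0 : ℝ) < (k + 1 : ℕ) := by positivity
    have h := (hsmem k).2
    rw [div_le_one hKpos] at h
    exact_mod_cast h
  have hθmem : θ ∈ Set.Icc (0 : ℝ) 1 := ⟨hθ0, hθ1⟩
  have hin : Tendsto (fun k : ℕ => (⌊θ * (k + 1 : ℕ)⌋₊ : ℝ) / (k + 1 : ℕ)) atTop (𝓝[Set.Icc (0 : ℝ) 1] θ) :=
    tendsto_nhdsWithin_iff.2 ⟨tendsto_floor_div θ hθ0, Eventually.of_forall hsmem⟩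
  have hFlim := (hFc θ hθmem).tendsto.comp hin
  have hGlim := (hGc θ hθmem).tendsto.comp hin
  refine le_of_tendsto_of_tendsto hGlim hFlim (Eventually.of_forall fun k => ?_)
  simp only [Function.comp_apply]
  exact pressureTT'₂_ratConcave' hβ t t' hU hx₁ hy₁ hx₂ hy₂ k _ (hale k)

/-- **Joint concavity of the spin-resolved thermal pressure**: `(n↑, n↓) ↦ p(β; t,t',U; n↑, n↓)` is concave on
`[0,1) × [0,1)` (`β ≥ 0`, `U ≥ 0`). [cite: Ruelle1969, §3.4] -/
theorem concaveOn_pressureTT'₂ :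
    ConcaveOn ℝ (Set.Ico (0 : ℝ) 1 ×ˢ Set.Ico (0 : ℝ) 1) (fun z : ℝ × ℝ => pressureTT'₂ β t t' U z.1 z.2) := by
  refine ⟨(convex_Ico 0 1).prod (convex_Ico 0 1), ?_⟩
  rintro ⟨x₁, y₁⟩ ⟨hx₁, hy₁⟩ ⟨x₂, y₂⟩ ⟨hx₂, hy₂⟩ θ θ' hθ hθ' hθθ'
  have hθ'eq : θ' = 1 - θ := by linarith
  rw [hθ'eq]
  simp only [smul_eq_mul, Prod.mk_add_mk, Prod.smul_mk]
  exact pressureTT'₂_concave_comb hβ t t' hU hx₁ hy₁ hx₂ hy₂ hθ (by linarith)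

end Concave

end ThermodynamicLimit

end Literature.MathematicalPhysics.QuantumLattice
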